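import Mathlib
import HarnessLib
import Summits.NavierStokesRegularity.NavierStokesRegularity.Theorems.HalfSpaceWindowDoorCirculationCarryingRigidityAngularMeanDrift

/-!
# Route `HalfSpaceWindowDoor`, crux `CirculationCarryingRigidity` (stmt-NavierStokesRegularity-25311) — the MEAN SWIRL
# VELOCITY `V = Γ/(2πr)` of a door-class profile: its drift–diffusion law off the axis (kinematics for the first census
# theorem in the TIME-ONLY class)

Line `eddy_torque` (LEAD ns-hsw-p1 g5).  All census theorems of this crux so far live in the AXIS-TYPE-I subclass
`‖v(x,t)‖ ≤ D/(|x_h| + √(−t))`, where the axis circulation `Γ = ∮ v_θ dl ≤ 2πD` is bounded and KNSS-type Liouville theorems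
for `F = (2π)⁻¹Γ` apply.  In the door class itself (`‖v(·,t)‖ ≤ C/√(−t)` only) `Γ ≤ 2πrC/√(−s)` is unbounded, but the MEAN
SWIRL VELOCITY `V := Γ/(2πr) = v̄_θ` is bounded, `0 ≤ V ≤ C/√(−s)` under the sign `ω₃ ≥ 0`, and DECAYS in the far past.  This
file computes its law off the axis from the circle law in remainder form (`…AngularMeanDrift.deriv_circ_s_eq_remainder`):

  `∂ₛV + ⟨v⟩_θ·∇V − ΔV = (2πr)⁻¹ · (ℛ − v̄_r Γ/r − Γ/r²)`        (`V_law`),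

so that `V` is a SUBSOLUTION of the drift–diffusion operator with the bounded drift `⟨v⟩_θ` wherever the eddy torque obeys
`ℛ ≤ (1 + r v̄_r) Γ/r²` (`V_subsolution`) — e.g. under mean OUTFLOW `v̄_r ≥ 0` with eddy spin-down `ℛ ≤ 0`.  The whole-space
maximum principle `…WholeSpaceMaxPrinciple.le_of_subsolution` then forces `V ≡ 0` (file `…TimeOnlyOutflow`).

Technique: `V(s,·)` is the lift (`…AxisLift.lift`) of the meridian profile `(r,z,s) ↦ χ(r)·Γ(r,z,s)/(2πr)` cut off near the
axis (`…AxisLift.cutoff`), which is `C²` on `{s < 0}`; `laplacian_lift` / `gradient_lift` give `ΔV`, `∇V` off the axis, and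
the one-variable quotient rule turns `Γ`-derivatives into `V`-derivatives.

All statements concern HYPOTHETICAL profiles; nothing here is a regularity claim for Navier–Stokes.
-/

set_option linter.dupNamespace false
set_option autoImplicit false

namespace Summit.NavierStokesRegularity.NavierStokesRegularity.Theorems.HalfSpaceWindowDoorCirculationCarryingRigidityTimeOnlyVEquation

open Set Filter Topology Function
open scoped Laplacian RealInnerProductSpace ContDiff Classical
open Literature.Analysis Literature.Analysis.FluidPDE
open Summit.NavierStokesRegularity.NavierStokesRegularity.Theorems.AxisTwistDoorAveragedConeLiouvilleDefs
  (cylPt eT e3 circ vortCirc radVortCirc meanR meanZ remainder SignE3)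
open Summit.NavierStokesRegularity.NavierStokesRegularity.Theorems.AveragedConeLiouville.CircleStokes
  (deriv_circ_eq_vortCirc hasDerivAt_circ)
open Summit.NavierStokesRegularity.NavierStokesRegularity.Theorems.AveragedConeLiouville.CircleCalculus
  (deriv_circ_z hasDerivAt_circ_z)
open Summit.NavierStokesRegularity.NavierStokesRegularity.Theorems.AxisTwistDoorAveragedConeLiouvilleAxisLift
  (lift gradient_lift contDiffAt_lift laplacian_lift cutoff contDiff_cutoff cutoff_eq_zero cutoff_eq_one)
open Summit.NavierStokesRegularity.NavierStokesRegularity.Theorems.HalfSpaceWindowDoorCirculationCarryingRigidityAxisCirculation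
open Summit.NavierStokesRegularity.NavierStokesRegularity.Theorems.HalfSpaceWindowDoorCirculationCarryingRigidityAngularMeanDrift
  (deriv_circ_s_eq_remainder angularMean_radialVelocity angularMean_axialVelocity inner_eZ_left)

variable {C : ℝ} {v : ℝ → EuclideanSpace ℝ (Fin 3) → EuclideanSpace ℝ (Fin 3)}

/-! ### One-variable calculus: the quotient `G/r` -/

/-- For `G ∈ C²(ℝ)` and `r ≠ 0`: `(G/r)'' + r⁻¹(G/r)' = r⁻¹·(G'' − r⁻¹G' + G/r²)` at `r`. -/
theorem quotient_rule_two {G : ℝ → ℝ} (hG : ContDiff ℝ 2 G) {r : ℝ} (hr : r ≠ 0) :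
    deriv (fun r' => deriv (fun r'' => G r'' / r'') r') r + r⁻¹ * deriv (fun r' => G r' / r') r =
      r⁻¹ * (deriv (deriv G) r - r⁻¹ * deriv G r + G r / r ^ 2) := by
  have hG' := (contDiff_succ_iff_deriv.1 (show ContDiff ℝ (1 + 1) G from hG))
  have hGd : Differentiable ℝ G := hG'.1
  have hG1 : ContDiff ℝ 1 (deriv G) := hG'.2.2
  have hG'd : Differentiable ℝ (deriv G) := hG1.differentiable one_ne_zero
  have hq : ∀ r' : ℝ, r' ≠ 0 →
      HasDerivAt (fun r'' => G r'' / r'') ((deriv G r' * r' - G r' * 1) / r' ^ 2) r' :=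
    fun r' hr' => ((hGd r').hasDerivAt).div (hasDerivAt_id r') hr'
  have hq1 : deriv (fun r' => G r' / r') r = (deriv G r * r - G r) / r ^ 2 := by
    rw [(hq r hr).deriv, mul_one]
  have hev : deriv (fun r'' => G r'' / r'') =ᶠ[𝓝 r] fun r' => (deriv G r' * r' - G r') / r ^ 2 * (r ^ 2 / r' ^ 2) := by
    filter_upwards [isOpen_ne.mem_nhds hr] with r' hr'
    rw [(hq r' hr').deriv, mul_one]
    field_simp
  have hN : HasDerivAt (fun r' => (deriv G r' * r' - G r') / r ^ 2 * (r ^ 2 / r' ^ 2))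
      (((deriv (deriv G) r * r + deriv G r * 1 - deriv G r) / r ^ 2) * (r ^ 2 / r ^ 2)
        + (deriv G r * r - G r) / r ^ 2 * (-(r ^ 2 * (2 * r)) / (r ^ 2) ^ 2)) r := by
    refine HasDerivAt.mul ?_ ?_
    · exact ((((hG'd r).hasDerivAt).mul (hasDerivAt_id r)).sub (hGd r).hasDerivAt).div_const _
    · have h2 : HasDerivAt (fun r' : ℝ => r' ^ 2) (2 * r) r := by
        simpa using (hasDerivAt_pow 2 r)
      have h : HasDerivAt (fun r' : ℝ => r ^ 2 / r' ^ 2) ((0 * r ^ 2 - r ^ 2 * (2 * r)) / (r ^ 2) ^ 2) r :=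
        (hasDerivAt_const r (r ^ 2)).div h2 (pow_ne_zero 2 hr)
      have he : (0 * r ^ 2 - r ^ 2 * (2 * r)) / (r ^ 2) ^ 2 = -(r ^ 2 * (2 * r)) / (r ^ 2) ^ 2 := by ring
      rw [he] at h
      exact h
  rw [hev.deriv_eq, hN.deriv, hq1]
  field_simp
  ring

/-- For `H ∈ C²(ℝ)` and a constant `c`: `(c·H)'' = c·H''`. -/
theorem deriv_deriv_const_mul {H : ℝ → ℝ} (hH : ContDiff ℝ 2 H) (c z : ℝ) :
    deriv (fun z' => deriv (fun z'' => c * H z'') z') z = c * deriv (deriv H) z := by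
  have hH' := (contDiff_succ_iff_deriv.1 (show ContDiff ℝ (1 + 1) H from hH))
  have hHd : Differentiable ℝ H := hH'.1
  have hH'd : Differentiable ℝ (deriv H) := hH'.2.2.differentiable one_ne_zero
  have h1 : (fun z' => deriv (fun z'' => c * H z'') z') = fun z' => c * deriv H z' := by
    funext z'
    exact deriv_const_mul c (hHd z')
  rw [h1, deriv_const_mul c (hH'd z)]

/-! ### The cut-off meridian profile `χ_ρ(r)·Γ(r,z,s)/(2πr)` -/

/-- The cut-off profile is `C²` on `{s < 0}` (the cut-off kills a neighbourhood of the axis `r = 0`). -/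
theorem profile_contDiffOn (hv : IsSmoothSpaceTimeOn (Iio (0 : ℝ)) v) {ρ : ℝ} (hρ : 0 < ρ) :
    ContDiffOn ℝ 2 (fun q : ℝ × ℝ × ℝ => cutoff ρ (q.1, q.2.1) * ((2 * Real.pi)⁻¹ * circ v q.1 q.2.1 q.2.2 / q.1))
      {q | q.2.2 < 0} := by
  have hΓ := contDiffOn_circ hv
  intro q hq
  by_cases h : ρ / 4 < q.1
  · have hχ : ContDiffWithinAt ℝ 2 (fun q' : ℝ × ℝ × ℝ => cutoff ρ (q'.1, q'.2.1)) {q | q.2.2 < 0} q :=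
      ((contDiff_cutoff ρ (n := 2)).comp (contDiff_fst.prodMk (contDiff_fst.comp contDiff_snd))).contDiffAt
        |>.contDiffWithinAt
    have hq1 : q.1 ≠ 0 := by intro h0; rw [h0] at h; linarith
    exact hχ.mul ((contDiffWithinAt_const.mul (hΓ q hq)).div contDiffWithinAt_fst hq1)
  · have hlt : q.1 < ρ / 2 := by linarith [not_lt.1 h]
    have hev : (fun q' : ℝ × ℝ × ℝ => cutoff ρ (q'.1, q'.2.1) * ((2 * Real.pi)⁻¹ * circ v q'.1 q'.2.1 q'.2.2 / q'.1))
        =ᶠ[𝓝[{q | q.2.2 < 0}] q] fun _ => (0 : ℝ) := by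
      have hopen : IsOpen {q' : ℝ × ℝ × ℝ | q'.1 < ρ / 2} := isOpen_lt continuous_fst continuous_const
      filter_upwards [mem_nhdsWithin_of_mem_nhds (hopen.mem_nhds hlt)] with q' hq'
      rw [cutoff_eq_zero hρ (show (q'.1, q'.2.1).1 < ρ / 2 from hq'), zero_mul]
    exact contDiffWithinAt_const.congr_of_eventuallyEq hev
      (by rw [cutoff_eq_zero hρ (show (q.1, q.2.1).1 < ρ / 2 from hlt), zero_mul])

/-- Off the cut-off region the lifted profile IS the mean swirl velocity `V(s,·) = Γ/(2πr)`, near any point `x` with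
`|x_h| > ρ`. -/
theorem lift_profile_eventuallyEq {ρ : ℝ} (hρ : 0 < ρ) {x : EuclideanSpace ℝ (Fin 3)} (hx : ρ < cylRadius x) (σ : ℝ) :
    lift (fun r z σ' => cutoff ρ (r, z) * ((2 * Real.pi)⁻¹ * circ v r z σ' / r)) σ =ᶠ[𝓝 x]
      fun y => (2 * Real.pi)⁻¹ * circ v (cylRadius y) (y 2) σ / cylRadius y := by
  have hopen : IsOpen {y : EuclideanSpace ℝ (Fin 3) | ρ < cylRadius y} := isOpen_lt continuous_const continuous_cylRadius
  filter_upwards [hopen.mem_nhds hx] with y hy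
  show cutoff ρ (cylRadius y, y 2) * ((2 * Real.pi)⁻¹ * circ v (cylRadius y) (y 2) σ / cylRadius y) = _
  rw [cutoff_eq_one hρ (show ρ ≤ (cylRadius y, y 2).1 from hy.le), one_mul]

/-- The radial slice of the profile agrees with `r ↦ Γ(r,z,s)/(2πr)` near any `r₁ > ρ`. -/
theorem profile_radial_eventuallyEq {ρ : ℝ} (hρ : 0 < ρ) {r₁ : ℝ} (hr₁ : ρ < r₁) (z σ : ℝ) :
    (fun r' => cutoff ρ (r', z) * ((2 * Real.pi)⁻¹ * circ v r' z σ / r')) =ᶠ[𝓝 r₁]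
      fun r' => (2 * Real.pi)⁻¹ * circ v r' z σ / r' := by
  filter_upwards [(isOpen_lt continuous_const continuous_id).mem_nhds hr₁] with r' hr'
  rw [cutoff_eq_one hρ (show ρ ≤ (r', z).1 from le_of_lt hr'), one_mul]

/-- The axial slice of the profile at a radius `r₁ ≥ ρ` is `z ↦ Γ(r₁,z,s)/(2πr₁)` exactly. -/
theorem profile_axial_eq {ρ : ℝ} (hρ : 0 < ρ) {r₁ : ℝ} (hr₁ : ρ ≤ r₁) (σ : ℝ) :
    (fun z' => cutoff ρ (r₁, z') * ((2 * Real.pi)⁻¹ * circ v r₁ z' σ / r₁)) =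
      fun z' => ((2 * Real.pi)⁻¹ * r₁⁻¹) * circ v r₁ z' σ := by
  funext z'
  rw [cutoff_eq_one hρ (show ρ ≤ (r₁, z').1 from hr₁), one_mul]
  ring

/-! ### Smoothness of the slices of `Γ` -/

/-- `r ↦ Γ(r,z,s)` is `C²` for `s < 0`. -/
theorem contDiff_circ_radial (hv : IsSmoothSpaceTimeOn (Iio (0 : ℝ)) v) {σ : ℝ} (hσ : σ < 0) (z : ℝ) :
    ContDiff ℝ 2 fun r' => circ v r' z σ := by
  have hΓ := contDiffOn_circ hv
  have hmap : ContDiff ℝ 2 fun r' : ℝ => ((r', z, σ) : ℝ × ℝ × ℝ) :=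
    contDiff_id.prodMk (contDiff_const.prodMk contDiff_const)
  exact hΓ.comp_contDiff hmap fun r' => hσ

/-- `z ↦ Γ(r,z,s)` is `C²` for `s < 0`. -/
theorem contDiff_circ_axial (hv : IsSmoothSpaceTimeOn (Iio (0 : ℝ)) v) {σ : ℝ} (hσ : σ < 0) (r : ℝ) :
    ContDiff ℝ 2 fun z' => circ v r z' σ := by
  have hΓ := contDiffOn_circ hv
  have hmap : ContDiff ℝ 2 fun z' : ℝ => ((r, z', σ) : ℝ × ℝ × ℝ) :=
    contDiff_const.prodMk (contDiff_id.prodMk contDiff_const)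
  exact hΓ.comp_contDiff hmap fun z' => hσ

/-! ### The Laplacian, the drift derivative and the time derivative of `V = Γ/(2πr)` off the axis -/

/-- **`ΔV` off the axis**: `ΔV = (2π)⁻¹·(r⁻¹(Γ_rr − r⁻¹Γ_r + Γ/r²) + r⁻¹Γ_zz)` at `(r,z) = (|x_h|, x₃)`. -/
theorem laplacian_V (hv : IsSmoothSpaceTimeOn (Iio (0 : ℝ)) v) {σ : ℝ} (hσ : σ < 0)
    {x : EuclideanSpace ℝ (Fin 3)} (hx : cylRadius x ≠ 0) :
    (Δ (fun y : EuclideanSpace ℝ (Fin 3) => (2 * Real.pi)⁻¹ * circ v (cylRadius y) (y 2) σ / cylRadius y)) x =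
      (2 * Real.pi)⁻¹ * ((cylRadius x)⁻¹ *
          (deriv (fun r' => deriv (fun r'' => circ v r'' (x 2) σ) r') (cylRadius x)
            - (cylRadius x)⁻¹ * deriv (fun r' => circ v r' (x 2) σ) (cylRadius x)
            + circ v (cylRadius x) (x 2) σ / cylRadius x ^ 2)
        + (cylRadius x)⁻¹ * deriv (fun z' => deriv (fun z'' => circ v (cylRadius x) z'' σ) z') (x 2)) := by
  have hr0 : 0 < cylRadius x := lt_of_le_of_ne (cylRadius_nonneg x) (Ne.symm hx)
  set ρ : ℝ := cylRadius x / 2 with hρdef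
  have hρ : 0 < ρ := by rw [hρdef]; linarith
  have hρx : ρ < cylRadius x := by rw [hρdef]; linarith
  have hP := profile_contDiffOn hv hρ
  rw [← (InnerProductSpace.laplacian_congr_nhds (lift_profile_eventuallyEq (v := v) hρ hρx σ)).eq_of_nhds,
    laplacian_lift hP hσ hx]
  -- the radial derivatives of the profile near `r₁ = |x_h|`
  have hev := profile_radial_eventuallyEq (v := v) hρ hρx (x 2) σ
  have hG := contDiff_circ_radial hv hσ (x 2)
  have hG2 : ContDiff ℝ 2 fun r' => (2 * Real.pi)⁻¹ * circ v r' (x 2) σ := contDiff_const.mul hG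
  have h1 : deriv (fun r' => cutoff ρ (r', x 2) * ((2 * Real.pi)⁻¹ * circ v r' (x 2) σ / r')) (cylRadius x) =
      deriv (fun r' => (2 * Real.pi)⁻¹ * circ v r' (x 2) σ / r') (cylRadius x) := hev.deriv_eq
  have h2 : deriv (fun r' => deriv (fun r'' => cutoff ρ (r'', x 2) * ((2 * Real.pi)⁻¹ * circ v r'' (x 2) σ / r'')) r')
      (cylRadius x) = deriv (fun r' => deriv (fun r'' => (2 * Real.pi)⁻¹ * circ v r'' (x 2) σ / r'') r') (cylRadius x) :=
    hev.deriv.deriv_eq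
  have h3 := profile_axial_eq (v := v) hρ hρx.le σ
  rw [h1, h2, h3, deriv_deriv_const_mul (contDiff_circ_axial hv hσ (cylRadius x)) _ (x 2),
    quotient_rule_two hG2 hx]
  have hGd : Differentiable ℝ fun r' => circ v r' (x 2) σ := hG.differentiable two_ne_zero
  have hd1 : deriv (fun r' => (2 * Real.pi)⁻¹ * circ v r' (x 2) σ) =
      fun r' => (2 * Real.pi)⁻¹ * deriv (fun r'' => circ v r'' (x 2) σ) r' := by
    funext r'
    exact deriv_const_mul _ (hGd r')
  have hG'd : Differentiable ℝ (deriv fun r' => circ v r' (x 2) σ) :=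
    ((contDiff_succ_iff_deriv.1 (show ContDiff ℝ (1 + 1) _ from hG)).2.2).differentiable one_ne_zero
  have hd2 : deriv (deriv fun r' => (2 * Real.pi)⁻¹ * circ v r' (x 2) σ) (cylRadius x) =
      (2 * Real.pi)⁻¹ * deriv (deriv fun r'' => circ v r'' (x 2) σ) (cylRadius x) := by
    rw [hd1, deriv_const_mul _ (hG'd _)]
  rw [hd2, hd1]
  field_simp

/-- **`∇V·⟨v⟩_θ` off the axis**: `DV(x)[⟨v(s)⟩_θ(x)] = (2π)⁻¹·(v̄_r·(r ∮ω₃ − Γ)/r² − v̄_z·∮ω_r/r)`. -/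
theorem fderiv_V_angularMeanVec (hv : IsSmoothSpaceTimeOn (Iio (0 : ℝ)) v) {σ : ℝ} (hσ : σ < 0)
    {x : EuclideanSpace ℝ (Fin 3)} (hx : cylRadius x ≠ 0) :
    fderiv ℝ (fun y : EuclideanSpace ℝ (Fin 3) => (2 * Real.pi)⁻¹ * circ v (cylRadius y) (y 2) σ / cylRadius y) x
        (angularMeanVec (v σ) x) =
      (2 * Real.pi)⁻¹ *
        (meanR v (cylRadius x) (x 2) σ *
            ((vortCirc v (cylRadius x) (x 2) σ * cylRadius x - circ v (cylRadius x) (x 2) σ) / cylRadius x ^ 2)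
          - meanZ v (cylRadius x) (x 2) σ * radVortCirc v (cylRadius x) (x 2) σ / cylRadius x) := by
  have hr0 : 0 < cylRadius x := lt_of_le_of_ne (cylRadius_nonneg x) (Ne.symm hx)
  set ρ : ℝ := cylRadius x / 2 with hρdef
  have hρ : 0 < ρ := by rw [hρdef]; linarith
  have hρx : ρ < cylRadius x := by rw [hρdef]; linarith
  have hP := profile_contDiffOn hv hρ
  have hv1 : ContDiff ℝ 1 (v σ) := (hv.contDiff_slice hσ).of_le (by norm_cast)
  have hvc : Continuous (v σ) := hv1.continuous
  rw [← (lift_profile_eventuallyEq (v := v) hρ hρx σ).fderiv_eq]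
  have hinner : fderiv ℝ (lift (fun r z σ' => cutoff ρ (r, z) * ((2 * Real.pi)⁻¹ * circ v r z σ' / r)) σ) x
        (angularMeanVec (v σ) x) =
      inner ℝ (gradient (lift (fun r z σ' => cutoff ρ (r, z) * ((2 * Real.pi)⁻¹ * circ v r z σ' / r)) σ) x)
        (angularMeanVec (v σ) x) := by
    rw [gradient, InnerProductSpace.toDual_symm_apply]
  rw [hinner, gradient_lift hP hσ hx, inner_add_left, real_inner_smul_left, real_inner_smul_left,
    real_inner_comm (angularMeanVec (v σ) x) (eR x), inner_angularMeanVec_eR hvc,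
    angularMean_radialVelocity (v σ) hx σ v rfl, inner_eZ_left, angularMeanVec_apply_two hvc,
    angularMean_axialVelocity v σ x]
  -- the slice derivatives of the profile at `(r,z) = (|x_h|, x₃)`
  have hev := profile_radial_eventuallyEq (v := v) hρ hρx (x 2) σ
  have hG := contDiff_circ_radial hv hσ (x 2)
  have hGd : Differentiable ℝ fun r' => circ v r' (x 2) σ := hG.differentiable two_ne_zero
  have hq : HasDerivAt (fun r' => (2 * Real.pi)⁻¹ * circ v r' (x 2) σ / r')
      ((((2 * Real.pi)⁻¹ * deriv (fun r' => circ v r' (x 2) σ) (cylRadius x)) * cylRadius x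
        - (2 * Real.pi)⁻¹ * circ v (cylRadius x) (x 2) σ * 1) / cylRadius x ^ 2) (cylRadius x) :=
    (((hGd _).hasDerivAt).const_mul _).div (hasDerivAt_id _) hx
  have h1 : deriv (fun r' => cutoff ρ (r', x 2) * ((2 * Real.pi)⁻¹ * circ v r' (x 2) σ / r')) (cylRadius x) =
      ((2 * Real.pi)⁻¹ * deriv (fun r' => circ v r' (x 2) σ) (cylRadius x)) * cylRadius x / cylRadius x ^ 2
        - (2 * Real.pi)⁻¹ * circ v (cylRadius x) (x 2) σ / cylRadius x ^ 2 := by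
    rw [hev.deriv_eq, hq.deriv]
    ring
  have h3 := profile_axial_eq (v := v) hρ hρx.le σ
  have hH := contDiff_circ_axial hv hσ (cylRadius x)
  have hHd : Differentiable ℝ fun z' => circ v (cylRadius x) z' σ := hH.differentiable two_ne_zero
  have h2 : deriv (fun z' => cutoff ρ (cylRadius x, z') * ((2 * Real.pi)⁻¹ * circ v (cylRadius x) z' σ / cylRadius x))
      (x 2) = ((2 * Real.pi)⁻¹ * (cylRadius x)⁻¹) * deriv (fun z' => circ v (cylRadius x) z' σ) (x 2) := by
    rw [h3, deriv_const_mul _ (hHd _)]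
  rw [h1, h2, deriv_circ_eq_vortCirc v hv1, deriv_circ_z v hv1]
  field_simp
  ring

/-- **Time derivative of `V` off the axis**: `∂ₛV = (2π)⁻¹ ∂ₛΓ / r`. -/
theorem hasDerivAt_V_time (hv : IsSmoothSpaceTimeOn (Iio (0 : ℝ)) v) {σ : ℝ} (hσ : σ < 0)
    (x : EuclideanSpace ℝ (Fin 3)) :
    HasDerivAt (fun σ' => (2 * Real.pi)⁻¹ * circ v (cylRadius x) (x 2) σ' / cylRadius x)
      ((2 * Real.pi)⁻¹ * deriv (fun s' => circ v (cylRadius x) (x 2) s') σ / cylRadius x) σ :=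
  (hasDerivAt_circF_time hv hσ x).div_const _

/-! ### The law of `V` and the subsolution property -/

/-- **The law of the mean swirl velocity** in the door class, off the axis at a negative time:
`∂ₛV + DV[⟨v⟩_θ] − ΔV = (2πr)⁻¹·(ℛ − v̄_r Γ/r − Γ/r²)`. -/
theorem V_law (hrate : HasTypeITimeDecay C v)
    (hcont : ContinuousOn (uncurry v) (Iio (0 : ℝ) ×ˢ univ))
    (hmild : ∀ s t : ℝ, s < t → t < 0 → ∀ x,
      v t x = UnboundedOperators.heatExtension (v s) (t - s) x - oseenDuhamel 1 s v v t x)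
    (hdiv : ∀ t < 0, VectorCalculus.IsDivFree (v t)) {σ : ℝ} (hσ : σ < 0)
    {x : EuclideanSpace ℝ (Fin 3)} (hx : cylRadius x ≠ 0) :
    deriv (fun σ' => (2 * Real.pi)⁻¹ * circ v (cylRadius x) (x 2) σ' / cylRadius x) σ
        + fderiv ℝ (fun y : EuclideanSpace ℝ (Fin 3) => (2 * Real.pi)⁻¹ * circ v (cylRadius y) (y 2) σ / cylRadius y) x
            (angularMeanVec (v σ) x)
        - (Δ (fun y : EuclideanSpace ℝ (Fin 3) => (2 * Real.pi)⁻¹ * circ v (cylRadius y) (y 2) σ / cylRadius y)) x =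
      (2 * Real.pi)⁻¹ * (cylRadius x)⁻¹ *
        (remainder v (cylRadius x) (x 2) σ
          - meanR v (cylRadius x) (x 2) σ * circ v (cylRadius x) (x 2) σ / cylRadius x
          - circ v (cylRadius x) (x 2) σ / cylRadius x ^ 2) := by
  have hsm : IsSmoothSpaceTimeOn (Iio (0 : ℝ)) v := isSmoothSpaceTimeOn_of_class hrate hcont hmild hdiv
  have hr0 : 0 < cylRadius x := lt_of_le_of_ne (cylRadius_nonneg x) (Ne.symm hx)
  have hv1 : ContDiff ℝ 1 (v σ) := (hsm.contDiff_slice hσ).of_le (by norm_cast)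
  rw [(hasDerivAt_V_time hsm hσ x).deriv, fderiv_V_angularMeanVec hsm hσ hx, laplacian_V hsm hσ hx,
    deriv_circ_s_eq_remainder hrate hcont hmild hdiv hσ hr0 (x 2), deriv_circ_eq_vortCirc v hv1]
  field_simp
  ring

/-- **`V` is a subsolution where the eddy torque obeys `ℛ ≤ (1 + r v̄_r)Γ/r²`**: at such an off-axis point,
`∂ₛV + DV[⟨v⟩_θ] − ΔV ≤ 0`. -/
theorem V_subsolution (hrate : HasTypeITimeDecay C v)
    (hcont : ContinuousOn (uncurry v) (Iio (0 : ℝ) ×ˢ univ))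
    (hmild : ∀ s t : ℝ, s < t → t < 0 → ∀ x,
      v t x = UnboundedOperators.heatExtension (v s) (t - s) x - oseenDuhamel 1 s v v t x)
    (hdiv : ∀ t < 0, VectorCalculus.IsDivFree (v t)) {σ : ℝ} (hσ : σ < 0)
    {x : EuclideanSpace ℝ (Fin 3)} (hx : cylRadius x ≠ 0)
    (hR : remainder v (cylRadius x) (x 2) σ ≤
      (1 + cylRadius x * meanR v (cylRadius x) (x 2) σ) * circ v (cylRadius x) (x 2) σ / cylRadius x ^ 2) :
    deriv (fun σ' => (2 * Real.pi)⁻¹ * circ v (cylRadius x) (x 2) σ' / cylRadius x) σ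
        + fderiv ℝ (fun y : EuclideanSpace ℝ (Fin 3) => (2 * Real.pi)⁻¹ * circ v (cylRadius y) (y 2) σ / cylRadius y) x
            (angularMeanVec (v σ) x)
        - (Δ (fun y : EuclideanSpace ℝ (Fin 3) => (2 * Real.pi)⁻¹ * circ v (cylRadius y) (y 2) σ / cylRadius y)) x
      ≤ 0 := by
  have hr0 : 0 < cylRadius x := lt_of_le_of_ne (cylRadius_nonneg x) (Ne.symm hx)
  rw [V_law hrate hcont hmild hdiv hσ hx]
  have hfac : 0 ≤ (2 * Real.pi)⁻¹ * (cylRadius x)⁻¹ := by positivity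
  apply mul_nonpos_of_nonneg_of_nonpos hfac
  have h : remainder v (cylRadius x) (x 2) σ
      - meanR v (cylRadius x) (x 2) σ * circ v (cylRadius x) (x 2) σ / cylRadius x
      - circ v (cylRadius x) (x 2) σ / cylRadius x ^ 2 =
      remainder v (cylRadius x) (x 2) σ
        - (1 + cylRadius x * meanR v (cylRadius x) (x 2) σ) * circ v (cylRadius x) (x 2) σ / cylRadius x ^ 2 := by
    field_simp
    ring
  rw [h]
  linarith

end Summit.NavierStokesRegularity.NavierStokesRegularity.Theorems.HalfSpaceWindowDoorCirculationCarryingRigidityTimeOnlyVEquation
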